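import Summits.ValiantsHypothesis.ValiantsHypothesis.Theorems.BarrierLeverAnchoredDoorHitsLowerPairsDefs

/-!
# Support item `AnchoredDoorHitsLowerPairs` (stmt-ValiantsHypothesis-22510), line `anchored-peeling`: the BASE CASE `r ≤ 1`

Helper file (`--supports stmt-ValiantsHypothesis-22510`; cell valiant-natproofs, rung V4, 𝒟-side door (c); prover seat val-np-p1
gen 14). Closes NO item. The proposed v3 sub-stub `stub_base` of HOME/val-np-p1/g14/STUBS-v3-anchored-peeling.md, proved:
`constantCoeff_symbolicWitness` (the symbolic anchored witness has constant term `1`: every anchor has nonempty parts), hence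
(`symbolicDet_of_le_one`, `stub_base`) on an injective lower-set layout with `r ≤ 1` (so `u 0 = w 0 = ∅`) the symbolic minor is `1 ≠ 0`.
This is the base of the strong induction on `r` in the proposed composition `stub_starStep → stub_base → stub_rigidPairs → stub_symbolicNonvanishing`.

WHAT THIS IS NOT: trivialities; nothing on the content stub, on crux stmt-ValiantsHypothesis-14610, or on `VP` versus `VNP`.
-/

set_option linter.dupNamespace false

namespace Summit.ValiantsHypothesis.ValiantsHypothesis.Theorems.BarrierLever.AnchoredPeeling

open Finset MvPolynomial

noncomputable section

variable {h : ℕ}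

/-- The proposed v3 sub-stub B (verbatim from STUBS-v3-anchored-peeling.md): base case `r ≤ 1`. -/
def Stmt.stub_base : Prop :=
  ∀ (s h r : ℕ) (u w : Fin r → Finset (Fin h)), Function.Injective u → Function.Injective w →
    IsLowerSet (Set.range u) → IsLowerSet (Set.range w) → r ≤ 1 → symbolicDet s h r u w ≠ 0

/-- The symbolic anchored witness has constant term `1`. -/
theorem constantCoeff_symbolicWitness (s h : ℕ) : constantCoeff (symbolicWitness s h) = 1 := by
  rw [symbolicWitness, map_prod]
  refine Finset.prod_eq_one (fun α hα => ?_)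
  have hA : α.1.Nonempty := by
    rw [anchors, Finset.mem_filter] at hα
    exact Finset.card_pos.mp (by omega)
  obtain ⟨a, ha⟩ := hA
  have hX : constantCoeff (∏ a ∈ α.1, X (Fin.castAdd h a) : MvPolynomial (Fin (h + h)) (MvPolynomial (Param h) ℂ)) = 0 := by
    rw [map_prod]
    exact Finset.prod_eq_zero ha (constantCoeff_X _ _)
  simp only [map_add, map_one, map_mul, hX, mul_zero, zero_mul, add_zero]

/-- A lower-set layout with one row has that row empty. -/
theorem eq_empty_of_lowerSet_one {u : Fin 1 → Finset (Fin h)} (hl : IsLowerSet (Set.range u)) : u 0 = ∅ := by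
  obtain ⟨i, hi⟩ : (∅ : Finset (Fin h)) ∈ Set.range u := hl (Finset.empty_subset (u 0)) ⟨0, rfl⟩
  rw [← hi, Fin.eq_zero i]

/-- **The symbolic minor of a layout with `r ≤ 1` rows (injective, lower) is `1`.** -/
theorem symbolicDet_of_le_one (s h r : ℕ) (u w : Fin r → Finset (Fin h))
    (hlu : IsLowerSet (Set.range u)) (hlw : IsLowerSet (Set.range w)) (hr : r ≤ 1) :
    symbolicDet s h r u w = 1 := by
  rcases Nat.le_one_iff_eq_zero_or_eq_one.mp hr with rfl | rfl
  · rw [symbolicDet, Matrix.det_isEmpty]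
  · rw [symbolicDet, Matrix.det_unique, Matrix.of_apply]
    have hu0 : u default = ∅ := eq_empty_of_lowerSet_one hlu
    have hw0 : w default = ∅ := eq_empty_of_lowerSet_one hlw
    rw [hu0, hw0, Finset.sum_empty, Finset.sum_empty, add_zero, ← constantCoeff_eq, constantCoeff_symbolicWitness]

/-- **Sub-stub B (base case).** -/
theorem stub_base : Stmt.stub_base := by
  intro s h r u w _ _ hlu hlw hr
  rw [symbolicDet_of_le_one s h r u w hlu hlw hr]
  exact one_ne_zero

end

end Summit.ValiantsHypothesis.ValiantsHypothesis.Theorems.BarrierLever.AnchoredPeeling
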